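import Summits.CriticalPhenomena.PercolationContinuityZ3.Theses.PercSubharmonicSquare
import Literature.Barriers.CriticalPhenomena.GaussianDominationRoute
import HarnessLib

/-!
# `PercSubharmonicSquare.UniformSubcritDecayCloses` (stmt-CriticalPhenomena-11639) — discharged

Support item of route `PercSubharmonicSquare` (sub-problem `PercolationContinuityZ3`), the
hypothesis `hC` of the route's deciding theorem `closes`: if for some exponent `a > 0` and some
constant `C` the pointwise bound `τ_p(0,x) ≤ C‖x‖^{-a}` holds for ALL `p < p_c(ℤ³)` and all
`x ≠ 0`, then `θ(p_c) = 0` on `ℤ³` (`PercolationContinuityZ3`).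

This is the `q = 1` closing of the Gaussian-domination route with an arbitrary exponent, PROVED in
tree as `Literature.Barriers.CriticalPhenomena.percolationContinuity_of_tau_le_rpow_subcrit`
(every `d ≥ 1`, every `a > 0`): the bound passes to `p = p_c` by left-continuity of `τ_p(0,x)` in
`p` (`tau_criticalProbI_le_of_forall_lt`, Grimmett 1999 §8.3 p. 203) and `θ(p_c)² ≤ τ_{p_c}(0,x) → 0`
(`theta_eq_zero_of_tau_le_rpow`, Grimmett 1999 §8.5 p. 213). The route file deliberately keeps the
barrier module out of its own import cone (cone repair 2026-08-15); this Theorems file imports it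
and discharges the item in one line at `d := 3`. The conclusion `PercolationContinuity 3` is
`Literature.Probability.Percolation.PercolationContinuityZ3` and hence the summit conjunct
`_root_.PercolationContinuityZ3` by definitional unfolding.
-/

namespace Summit.CriticalPhenomena.PercolationContinuityZ3.Theorems

/-- **`UniformSubcritDecayCloses` holds** (route `PercSubharmonicSquare`, item
stmt-CriticalPhenomena-11639): a `p`-uniform subcritical pointwise power bound
`τ_p(0,x) ≤ C‖x‖^{-a}` (`a > 0`, all `p < p_c(ℤ³)`, all `x ≠ 0`) implies `θ(p_c) = 0` on `ℤ³`.
One-line discharge by the in-tree theorem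
`Literature.Barriers.CriticalPhenomena.percolationContinuity_of_tau_le_rpow_subcrit` at `d = 3`
(Aizenman–Duminil-Copin–Sidoravicius 2015, Cor. 1.4 at `q = 1`; Grimmett 1999, §8.3 p. 203 and
§8.5 p. 213). -/
theorem uniformSubcritDecayCloses_proof :
    Summit.CriticalPhenomena.PercolationContinuityZ3.Theses.PercSubharmonicSquare.UniformSubcritDecayCloses := by
  unfold Summit.CriticalPhenomena.PercolationContinuityZ3.Theses.PercSubharmonicSquare.UniformSubcritDecayCloses
  intro a C ha h
  exact Literature.Barriers.CriticalPhenomena.percolationContinuity_of_tau_le_rpow_subcrit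
    (d := 3) (by norm_num) ha h

end Summit.CriticalPhenomena.PercolationContinuityZ3.Theorems
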